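import Summits.Ventures.HodgeRepro2.T5SU11JacobiMeanPhaseRateOutside
import Summits.Ventures.HodgeRepro2.T5SU11JacobiCovarianceRate
import Summits.Ventures.HodgeRepro2.T5SU11JacobiOrbitMomentRateAll

/-!
# The rate chapter OUTSIDE `0 ≤ λ ≤ 2`, part 2: `|k² Var(log|a|) − 1| ≤ (352 + 272c' + 308c'² + 200c'³ + 32c'⁴)/k` and
`|(k²/2) Cov(log|a|, |g·0|²) − 1| ≤ (358 + 273c' + 308c'² + 200c'³ + 32c'⁴)/k` for `λ ≥ 2` (and `λ ≤ 0`), `c' = λ(λ − 2)/2`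

From the rates of the mean and of the second moment of the phase outside the Jensen range
(`T5SU11JacobiMeanPhaseRateOutside`, `k ≥ 2c' + 4`):

* **`|k² Var_{k,λ}(log|a|) − 1| ≤ (352 + 272c' + 308c'² + 200c'³ + 32c'⁴)/k`** (`abs_sq_mul_variance_phase_sub_one_le_of_two_le`,
  `_of_nonpos`), with `|(k⟨log|a|⟩)² − 1| ≤ |k⟨log|a|⟩ − 1|(2 + |k⟨log|a|⟩ − 1|)` and `(16 + 8c' + 20c'²)/k ≤ 4 + 10c'`;
* **`|(k²/2) Cov_{k,λ}(log|a|, |g·0|²) − 1| ≤ (358 + 273c' + 308c'² + 200c'³ + 32c'⁴)/k`**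
  (`abs_sq_div_two_mul_covariance_sub_one_le_of_two_le`, `_of_nonpos`) — by the mean value theorem in the weight,
  exactly as `T5SU11JacobiCovarianceRate` does on the Jensen range, with `r_k(λ) = 1 − 2/k − 2c'/k² ∈ [1 − (2 + c')/k, 1]`.

* the correlation coefficient, for `k ≥ 2(352 + 272c' + …)`: **`|ρ_{k,λ} − 1| ≤ C(c')/k`**
  (`abs_correlation_phase_orbit_sq_sub_one_le_of_two_le`), through the elementary quotient lemma of
  `T5SU11JacobiCovarianceRate` and the orbit-variance rate of `T5SU11JacobiOrbitMomentRateAll`.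

With `T5SU11JacobiMeanPhaseRate` and `T5SU11JacobiCovarianceRate` (`0 ≤ λ ≤ 2`) every limit law of the mean, the
variance, the covariance and the correlation of the phase and the orbit radius now carries an explicit `O(1/k)` error
term for EVERY real spectral parameter. Constants explicit, not optimised. Nothing is claimed about (N).

Blind lane: Mathlib + the HodgeRepro2 prefix only; no sorry; axioms ⊆ {propext, Classical.choice,
Quot.sound}.
-/

namespace Summit.Ventures.HodgeRepro2.T5SU11JacobiCovarianceRateOutside

open MeasureTheory MeasureTheory.Measure Metric Set Filter Topology
open T5SU11Unimodular T5SU11Fibration T5SU11Cartan T5SU11OneParameter T5SU11CartanProjection T5HaarCircle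
  T5BergmanCoefficient T5SU11FibrationHaar T5SU11SphericalFunction T5SU11SphericalSymmetry
  T5SU11SphericalBounds T5SU11SphericalContinuous T5SU11JacobiLaplacePhase T5SU11PhaseLawLintegral
  T5SU11JacobiWeightDerivAll T5SU11JacobiPhaseTailGroup T5SU11JacobiPhaseLawRate T5SU11JacobiMeanPhaseRate
  T5SU11JacobiPhaseLawRateOutside T5SU11JacobiWeightRate T5SU11JacobiPhaseLowerOutside
  T5SU11JacobiMeanPhaseOutside T5SU11JacobiMeanPhaseRateOutside T5SU11JacobiWeightRecursion
  T5SU11JacobiPhaseOrbitCovariance T5SU11JacobiPhaseOrbitCovarianceAsymptotic T5SU11JacobiCovarianceRate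
  T5SU11JacobiOrbitMomentRateAll
open scoped Real

section measure

variable [MeasurableSpace Circle] [BorelSpace Circle]

/-! ### The variance -/

/-- **THE RATE OF THE VARIANCE OUTSIDE THE JENSEN RANGE**: for `λ ≥ 2`, `k ≥ 2c' + 4`,
`|k² Var_{k,λ}(log|a|) − 1| ≤ (352 + 272c' + 308c'² + 200c'³ + 32c'⁴)/k`. -/
theorem abs_sq_mul_variance_phase_sub_one_le_of_two_le {k lam : ℝ} (h2 : 2 ≤ lam)
    (hk : 2 * (lam * (lam - 2) / 2) + 4 ≤ k) :
    |k ^ 2 * ((∫ g, Real.log ‖mat g 0 0‖ ^ 2 * ((1 - ‖orbit g‖ ^ 2) ^ (k / 2) * sph lam g) ∂(nu haarCircle))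
          / (∫ g, (1 - ‖orbit g‖ ^ 2) ^ (k / 2) * sph lam g ∂(nu haarCircle))
        - ((∫ g, Real.log ‖mat g 0 0‖ * ((1 - ‖orbit g‖ ^ 2) ^ (k / 2) * sph lam g) ∂(nu haarCircle))
          / (∫ g, (1 - ‖orbit g‖ ^ 2) ^ (k / 2) * sph lam g ∂(nu haarCircle))) ^ 2) - 1|
      ≤ (352 + 272 * (lam * (lam - 2) / 2) + 308 * (lam * (lam - 2) / 2) ^ 2 + 200 * (lam * (lam - 2) / 2) ^ 3
          + 32 * (lam * (lam - 2) / 2) ^ 4) / k := by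
  set c : ℝ := lam * (lam - 2) / 2 with hc
  have hc0 : 0 ≤ c := by rw [hc]; exact div_nonneg (mul_nonneg (by linarith) (by linarith)) (by norm_num)
  have hk0 : 0 < k := by linarith
  have hA := abs_sq_mul_second_moment_sub_two_le_of_two_le h2 hk
  have hB := abs_mul_mean_phase_sub_one_le_of_two_le h2 hk
  rw [← hc] at hA hB
  set M2 : ℝ := (∫ g, Real.log ‖mat g 0 0‖ ^ 2 * ((1 - ‖orbit g‖ ^ 2) ^ (k / 2) * sph lam g) ∂(nu haarCircle))
    / (∫ g, (1 - ‖orbit g‖ ^ 2) ^ (k / 2) * sph lam g ∂(nu haarCircle)) with hM2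
  set M1 : ℝ := (∫ g, Real.log ‖mat g 0 0‖ * ((1 - ‖orbit g‖ ^ 2) ^ (k / 2) * sph lam g) ∂(nu haarCircle))
    / (∫ g, (1 - ‖orbit g‖ ^ 2) ^ (k / 2) * sph lam g ∂(nu haarCircle)) with hM1
  have e : k ^ 2 * (M2 - M1 ^ 2) - 1 = (k ^ 2 * M2 - 2) - ((k * M1) ^ 2 - 1) := by ring
  -- `C₁/k ≤ 4 + 10c` at `k ≥ 2c + 4`
  have hC1 : (16 + 8 * c + 20 * c ^ 2) / k ≤ 4 + 10 * c := by
    rw [div_le_iff₀ hk0]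
    nlinarith [mul_nonneg (by linarith : (0 : ℝ) ≤ 4 + 10 * c) (by linarith : (0 : ℝ) ≤ k - (2 * c + 4)),
      sq_nonneg c]
  have hC : |(k * M1) ^ 2 - 1| ≤ (96 + 208 * c + 200 * c ^ 2 + 200 * c ^ 3) / k := by
    rw [show (k * M1) ^ 2 - 1 = (k * M1 - 1) * (k * M1 + 1) by ring, abs_mul]
    have h1 : |k * M1 + 1| ≤ 2 + (16 + 8 * c + 20 * c ^ 2) / k := by
      rw [show k * M1 + 1 = (k * M1 - 1) + 2 by ring]
      calc |k * M1 - 1 + 2| ≤ |k * M1 - 1| + |(2 : ℝ)| := abs_add_le _ _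
        _ ≤ (16 + 8 * c + 20 * c ^ 2) / k + 2 := by rw [abs_two]; linarith
        _ = 2 + (16 + 8 * c + 20 * c ^ 2) / k := by ring
    calc |k * M1 - 1| * |k * M1 + 1| ≤ (16 + 8 * c + 20 * c ^ 2) / k * (2 + (16 + 8 * c + 20 * c ^ 2) / k) :=
          mul_le_mul hB h1 (abs_nonneg _) (by positivity)
      _ ≤ (16 + 8 * c + 20 * c ^ 2) / k * (2 + (4 + 10 * c)) :=
          mul_le_mul_of_nonneg_left (by linarith) (by positivity)
      _ = (96 + 208 * c + 200 * c ^ 2 + 200 * c ^ 3) / k := by ring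
  rw [e]
  calc |(k ^ 2 * M2 - 2) - ((k * M1) ^ 2 - 1)| ≤ |k ^ 2 * M2 - 2| + |(k * M1) ^ 2 - 1| := abs_sub _ _
    _ ≤ (256 + 64 * c + 108 * c ^ 2 + 32 * c ^ 4) / k + (96 + 208 * c + 200 * c ^ 2 + 200 * c ^ 3) / k :=
        add_le_add hA hC
    _ = (352 + 272 * c + 308 * c ^ 2 + 200 * c ^ 3 + 32 * c ^ 4) / k := by ring

/-! ### The covariance -/

/-- **THE RATE OF THE RESCALED COVARIANCE OUTSIDE THE JENSEN RANGE**: for `λ ≥ 2`, `k ≥ 2c' + 4`,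
`|(k²/2) Cov_{k,λ}(log|a|, |g·0|²) − 1| ≤ (358 + 273c' + 308c'² + 200c'³ + 32c'⁴)/k` — by the mean value theorem
in the weight (`T5SU11JacobiPhaseOrbitCovarianceAsymptotic.exists_mean_phase_sub_eq`) and the variance rate above. -/
theorem abs_sq_div_two_mul_covariance_sub_one_le_of_two_le {k lam : ℝ} (h2 : 2 ≤ lam)
    (hk : 2 * (lam * (lam - 2) / 2) + 4 ≤ k) :
    |k ^ 2 / 2 *
      ((∫ g, Real.log ‖mat g 0 0‖ * ‖orbit g‖ ^ 2 * ((1 - ‖orbit g‖ ^ 2) ^ (k / 2) * sph lam g)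
            ∂(nu haarCircle))
          / (∫ g, (1 - ‖orbit g‖ ^ 2) ^ (k / 2) * sph lam g ∂(nu haarCircle))
        - ((∫ g, Real.log ‖mat g 0 0‖ * ((1 - ‖orbit g‖ ^ 2) ^ (k / 2) * sph lam g) ∂(nu haarCircle))
            / (∫ g, (1 - ‖orbit g‖ ^ 2) ^ (k / 2) * sph lam g ∂(nu haarCircle)))
          * ((∫ g, ‖orbit g‖ ^ 2 * ((1 - ‖orbit g‖ ^ 2) ^ (k / 2) * sph lam g) ∂(nu haarCircle))
            / (∫ g, (1 - ‖orbit g‖ ^ 2) ^ (k / 2) * sph lam g ∂(nu haarCircle)))) - 1|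
      ≤ (358 + 273 * (lam * (lam - 2) / 2) + 308 * (lam * (lam - 2) / 2) ^ 2 + 200 * (lam * (lam - 2) / 2) ^ 3
          + 32 * (lam * (lam - 2) / 2) ^ 4) / k := by
  set c : ℝ := lam * (lam - 2) / 2 with hc
  have hc0 : 0 ≤ c := by rw [hc]; exact div_nonneg (mul_nonneg (by linarith) (by linarith)) (by norm_num)
  have hk0 : 0 < k := by linarith
  have hk4 : 4 ≤ k := by linarith
  have hk' : lam < k := by nlinarith
  rw [covariance_phase_orbit_sq_eq (by linarith) hk' (by linarith)]
  obtain ⟨ξ, hξ, he⟩ := exists_mean_phase_sub_eq (k := k) (lam := lam) (by linarith) hk' (by linarith)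
  rw [he]
  have hξ0 : 0 < ξ := by linarith [hξ.1]
  have hξk : 2 * c + 4 ≤ ξ := by linarith [hξ.1]
  set V : ℝ := (∫ g, Real.log ‖mat g 0 0‖ ^ 2 * ((1 - ‖orbit g‖ ^ 2) ^ (ξ / 2) * sph lam g) ∂(nu haarCircle))
        / (∫ g, (1 - ‖orbit g‖ ^ 2) ^ (ξ / 2) * sph lam g ∂(nu haarCircle))
      - ((∫ g, Real.log ‖mat g 0 0‖ * ((1 - ‖orbit g‖ ^ 2) ^ (ξ / 2) * sph lam g) ∂(nu haarCircle))
        / (∫ g, (1 - ‖orbit g‖ ^ 2) ^ (ξ / 2) * sph lam g ∂(nu haarCircle))) ^ 2 with hV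
  have hrate := abs_sq_mul_variance_phase_sub_one_le_of_two_le (k := ξ) h2 (by rw [← hc]; exact hξk)
  rw [← hc, ← hV] at hrate
  set C3 : ℝ := 352 + 272 * c + 308 * c ^ 2 + 200 * c ^ 3 + 32 * c ^ 4 with hC3
  have hC30 : 0 ≤ C3 := by rw [hC3]; positivity
  set x : ℝ := ξ ^ 2 * V with hx
  set q : ℝ := (k / ξ) ^ 2 with hq
  have hx1 : |x - 1| ≤ C3 / k := hrate.trans (div_le_div_of_nonneg_left hC30 hk0 hξ.1.le)
  have hq1 : q ≤ 1 := by
    rw [hq, div_pow, div_le_one (by positivity)]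
    exact pow_le_pow_left₀ hk0.le hξ.1.le 2
  have hq0 : 0 ≤ q := by rw [hq]; positivity
  have hq2 : 1 - q ≤ 4 / k := by
    refine le_trans ?_ (one_sub_div_add_two_sq_le k hk0)
    have : (k / (k + 2)) ^ 2 ≤ q := by
      rw [hq]
      exact pow_le_pow_left₀ (by positivity) (div_le_div_of_nonneg_left hk0.le hξ0 hξ.2.le) 2
    linarith
  -- `|k² (2V) − 2| ≤ 2 C₃/k + 8/k`
  have hD : |k ^ 2 * (2 * V) - 2| ≤ (2 * C3 + 8) / k := by
    have e : k ^ 2 * (2 * V) - 2 = 2 * q * (x - 1) + 2 * (q - 1) := by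
      rw [hx, hq, div_pow]
      field_simp
      ring
    have ha1 : |2 * q * (x - 1)| = 2 * q * |x - 1| := by
      rw [abs_mul, abs_of_nonneg (mul_nonneg (by norm_num) hq0)]
    have ha2 : |2 * (q - 1)| = 2 * (1 - q) := by
      rw [abs_mul, abs_of_nonneg (by norm_num : (0 : ℝ) ≤ 2), abs_of_nonpos (by linarith : q - 1 ≤ 0)]
      ring
    rw [e]
    calc |2 * q * (x - 1) + 2 * (q - 1)| ≤ |2 * q * (x - 1)| + |2 * (q - 1)| := abs_add_le _ _
      _ = 2 * q * |x - 1| + 2 * (1 - q) := by rw [ha1, ha2]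
      _ ≤ 2 * 1 * (C3 / k) + 2 * (4 / k) := by gcongr
      _ = (2 * C3 + 8) / k := by ring
  -- `r_k(λ) = 1 − 2/k − 2c/k² ∈ [1 − (2 + c)/k, 1]`
  have hr := weightRatio_eq hk0.ne' lam
  have hμ : lam * (lam - 2) = 2 * c := by rw [hc]; ring
  rw [hμ] at hr
  have hμ2 : 0 ≤ 2 * c / k ^ 2 := by positivity
  have hμ3 : 2 * c / k ^ 2 ≤ c / k := by
    rw [div_le_div_iff₀ (by positivity) hk0]
    nlinarith [mul_nonneg hc0 hk0.le]
  have hr1 : weightRatio k lam ≤ 1 := by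
    rw [hr]
    have : 0 ≤ 2 / k := by positivity
    linarith
  have hr0 : 1 - (2 + c) / k ≤ weightRatio k lam := by
    rw [hr, add_div]
    linarith
  have hr2 : |weightRatio k lam - 1| ≤ (2 + c) / k := by
    rw [abs_le]
    constructor <;> linarith
  have hrpos : 0 ≤ weightRatio k lam := by
    have : (2 + c) / k ≤ 1 := by
      rw [div_le_one hk0]
      linarith
    linarith
  have e : k ^ 2 / 2 * (weightRatio k lam * (2 * V)) - 1
      = (weightRatio k lam - 1) + weightRatio k lam * ((k ^ 2 * (2 * V) - 2) / 2) := by ring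
  rw [e]
  calc |(weightRatio k lam - 1) + weightRatio k lam * ((k ^ 2 * (2 * V) - 2) / 2)|
      ≤ |weightRatio k lam - 1| + |weightRatio k lam * ((k ^ 2 * (2 * V) - 2) / 2)| := abs_add_le _ _
    _ = |weightRatio k lam - 1| + weightRatio k lam * (|k ^ 2 * (2 * V) - 2| / 2) := by
        rw [abs_mul, abs_of_nonneg hrpos, abs_div, abs_of_pos (by norm_num : (0 : ℝ) < 2)]
    _ ≤ (2 + c) / k + 1 * (((2 * C3 + 8) / k) / 2) := by gcongr
    _ = (358 + 273 * c + 308 * c ^ 2 + 200 * c ^ 3 + 32 * c ^ 4) / k := by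
        rw [hC3]
        ring

/-! ### The twins for `λ ≤ 0` -/

/-- **The rate of the variance for `λ ≤ 0`** (by `φ_λ = φ_{2−λ}`). -/
theorem abs_sq_mul_variance_phase_sub_one_le_of_nonpos {k lam : ℝ} (h0 : lam ≤ 0)
    (hk : 2 * (lam * (lam - 2) / 2) + 4 ≤ k) :
    |k ^ 2 * ((∫ g, Real.log ‖mat g 0 0‖ ^ 2 * ((1 - ‖orbit g‖ ^ 2) ^ (k / 2) * sph lam g) ∂(nu haarCircle))
          / (∫ g, (1 - ‖orbit g‖ ^ 2) ^ (k / 2) * sph lam g ∂(nu haarCircle))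
        - ((∫ g, Real.log ‖mat g 0 0‖ * ((1 - ‖orbit g‖ ^ 2) ^ (k / 2) * sph lam g) ∂(nu haarCircle))
          / (∫ g, (1 - ‖orbit g‖ ^ 2) ^ (k / 2) * sph lam g ∂(nu haarCircle))) ^ 2) - 1|
      ≤ (352 + 272 * (lam * (lam - 2) / 2) + 308 * (lam * (lam - 2) / 2) ^ 2 + 200 * (lam * (lam - 2) / 2) ^ 3
          + 32 * (lam * (lam - 2) / 2) ^ 4) / k := by
  have e : (2 - lam) * (2 - lam - 2) / 2 = lam * (lam - 2) / 2 := by ring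
  have h := abs_sq_mul_variance_phase_sub_one_le_of_two_le (lam := 2 - lam) (k := k) (by linarith)
    (by rw [e]; exact hk)
  rw [e] at h
  simp_rw [← sph_two_sub lam] at h
  exact h

/-- **The rate of the rescaled covariance for `λ ≤ 0`** (by `φ_λ = φ_{2−λ}`). -/
theorem abs_sq_div_two_mul_covariance_sub_one_le_of_nonpos {k lam : ℝ} (h0 : lam ≤ 0)
    (hk : 2 * (lam * (lam - 2) / 2) + 4 ≤ k) :
    |k ^ 2 / 2 *
      ((∫ g, Real.log ‖mat g 0 0‖ * ‖orbit g‖ ^ 2 * ((1 - ‖orbit g‖ ^ 2) ^ (k / 2) * sph lam g)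
            ∂(nu haarCircle))
          / (∫ g, (1 - ‖orbit g‖ ^ 2) ^ (k / 2) * sph lam g ∂(nu haarCircle))
        - ((∫ g, Real.log ‖mat g 0 0‖ * ((1 - ‖orbit g‖ ^ 2) ^ (k / 2) * sph lam g) ∂(nu haarCircle))
            / (∫ g, (1 - ‖orbit g‖ ^ 2) ^ (k / 2) * sph lam g ∂(nu haarCircle)))
          * ((∫ g, ‖orbit g‖ ^ 2 * ((1 - ‖orbit g‖ ^ 2) ^ (k / 2) * sph lam g) ∂(nu haarCircle))
            / (∫ g, (1 - ‖orbit g‖ ^ 2) ^ (k / 2) * sph lam g ∂(nu haarCircle)))) - 1|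
      ≤ (358 + 273 * (lam * (lam - 2) / 2) + 308 * (lam * (lam - 2) / 2) ^ 2 + 200 * (lam * (lam - 2) / 2) ^ 3
          + 32 * (lam * (lam - 2) / 2) ^ 4) / k := by
  have e : (2 - lam) * (2 - lam - 2) / 2 = lam * (lam - 2) / 2 := by ring
  have h := abs_sq_div_two_mul_covariance_sub_one_le_of_two_le (lam := 2 - lam) (k := k) (by linarith)
    (by rw [e]; exact hk)
  rw [e] at h
  simp_rw [← sph_two_sub lam] at h
  exact h

/-! ### The correlation coefficient -/

/-- **THE RATE OF THE CORRELATION COEFFICIENT OUTSIDE THE JENSEN RANGE**: for `λ ≥ 2` and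
`k ≥ 2(352 + 272c' + 308c'² + 200c'³ + 32c'⁴)` (which makes the three rescaled second moments lie in `[1/2, 2]`),
`|ρ_{k,λ} − 1| ≤ 2((358 + 273c' + 308c'² + 200c'³ + 32c'⁴) + 2(352 + 272c' + 308c'² + 200c'³ + 32c'⁴) + (12 + 10c' + 2c'²))/k`,
`ρ_{k,λ} = Cov_{k,λ}(log|a|, |g·0|²)/√(Var_{k,λ}(log|a|) Var_{k,λ}(|g·0|²))` — from the three rates through
`T5SU11JacobiCovarianceRate.abs_div_sqrt_mul_sub_one_le` (the orbit variance rate is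
`T5SU11JacobiOrbitMomentRateAll.abs_sq_div_four_mul_variance_orbit_sq_sub_one_le_all` with `μ = 2c'`). -/
theorem abs_correlation_phase_orbit_sq_sub_one_le_of_two_le {k lam : ℝ} (h2 : 2 ≤ lam)
    (hk : 2 * (352 + 272 * (lam * (lam - 2) / 2) + 308 * (lam * (lam - 2) / 2) ^ 2 + 200 * (lam * (lam - 2) / 2) ^ 3
      + 32 * (lam * (lam - 2) / 2) ^ 4) ≤ k) :
    |((∫ g, Real.log ‖mat g 0 0‖ * ‖orbit g‖ ^ 2 * ((1 - ‖orbit g‖ ^ 2) ^ (k / 2) * sph lam g)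
            ∂(nu haarCircle))
          / (∫ g, (1 - ‖orbit g‖ ^ 2) ^ (k / 2) * sph lam g ∂(nu haarCircle))
        - ((∫ g, Real.log ‖mat g 0 0‖ * ((1 - ‖orbit g‖ ^ 2) ^ (k / 2) * sph lam g) ∂(nu haarCircle))
            / (∫ g, (1 - ‖orbit g‖ ^ 2) ^ (k / 2) * sph lam g ∂(nu haarCircle)))
          * ((∫ g, ‖orbit g‖ ^ 2 * ((1 - ‖orbit g‖ ^ 2) ^ (k / 2) * sph lam g) ∂(nu haarCircle))
            / (∫ g, (1 - ‖orbit g‖ ^ 2) ^ (k / 2) * sph lam g ∂(nu haarCircle))))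
      / Real.sqrt
        (((∫ g, Real.log ‖mat g 0 0‖ ^ 2 * ((1 - ‖orbit g‖ ^ 2) ^ (k / 2) * sph lam g) ∂(nu haarCircle))
            / (∫ g, (1 - ‖orbit g‖ ^ 2) ^ (k / 2) * sph lam g ∂(nu haarCircle))
          - ((∫ g, Real.log ‖mat g 0 0‖ * ((1 - ‖orbit g‖ ^ 2) ^ (k / 2) * sph lam g) ∂(nu haarCircle))
            / (∫ g, (1 - ‖orbit g‖ ^ 2) ^ (k / 2) * sph lam g ∂(nu haarCircle))) ^ 2)
        * ((∫ g, (‖orbit g‖ ^ 2) ^ 2 * ((1 - ‖orbit g‖ ^ 2) ^ (k / 2) * sph lam g) ∂(nu haarCircle))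
            / (∫ g, (1 - ‖orbit g‖ ^ 2) ^ (k / 2) * sph lam g ∂(nu haarCircle))
          - ((∫ g, ‖orbit g‖ ^ 2 * ((1 - ‖orbit g‖ ^ 2) ^ (k / 2) * sph lam g) ∂(nu haarCircle))
            / (∫ g, (1 - ‖orbit g‖ ^ 2) ^ (k / 2) * sph lam g ∂(nu haarCircle))) ^ 2)) - 1|
      ≤ 2 * ((358 + 273 * (lam * (lam - 2) / 2) + 308 * (lam * (lam - 2) / 2) ^ 2 + 200 * (lam * (lam - 2) / 2) ^ 3
            + 32 * (lam * (lam - 2) / 2) ^ 4)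
          + 2 * (352 + 272 * (lam * (lam - 2) / 2) + 308 * (lam * (lam - 2) / 2) ^ 2 + 200 * (lam * (lam - 2) / 2) ^ 3
            + 32 * (lam * (lam - 2) / 2) ^ 4)
          + (12 + 10 * (lam * (lam - 2) / 2) + 2 * (lam * (lam - 2) / 2) ^ 2)) / k := by
  set c : ℝ := lam * (lam - 2) / 2 with hc
  have hc0 : 0 ≤ c := by rw [hc]; exact div_nonneg (mul_nonneg (by linarith) (by linarith)) (by norm_num)
  set CB : ℝ := 352 + 272 * c + 308 * c ^ 2 + 200 * c ^ 3 + 32 * c ^ 4 with hCB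
  have hCB0 : 352 ≤ CB := by
    rw [hCB]
    nlinarith [pow_nonneg hc0 2, pow_nonneg hc0 3, pow_nonneg hc0 4]
  have hk0 : 0 < k := by linarith
  have hkc : 2 * c + 4 ≤ k := by nlinarith [pow_nonneg hc0 2, pow_nonneg hc0 3, pow_nonneg hc0 4]
  have hk' : lam < k := by nlinarith
  have hA := abs_sq_div_two_mul_covariance_sub_one_le_of_two_le (k := k) h2 (by rw [← hc]; exact hkc)
  have hB := abs_sq_mul_variance_phase_sub_one_le_of_two_le (k := k) h2 (by rw [← hc]; exact hkc)
  have hC := abs_sq_div_four_mul_variance_orbit_sq_sub_one_le_all (by linarith) hk' (by linarith)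
  rw [← hc] at hA hB
  have hμ : |lam * (lam - 2)| = 2 * c := by
    rw [hc, abs_of_nonneg (mul_nonneg (by linarith) (by linarith))]
    ring
  rw [hμ] at hC
  have hC' : |k ^ 2 / 4 * ((∫ g, (‖orbit g‖ ^ 2) ^ 2 * ((1 - ‖orbit g‖ ^ 2) ^ (k / 2) * sph lam g) ∂(nu haarCircle))
          / (∫ g, (1 - ‖orbit g‖ ^ 2) ^ (k / 2) * sph lam g ∂(nu haarCircle))
        - ((∫ g, ‖orbit g‖ ^ 2 * ((1 - ‖orbit g‖ ^ 2) ^ (k / 2) * sph lam g) ∂(nu haarCircle))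
          / (∫ g, (1 - ‖orbit g‖ ^ 2) ^ (k / 2) * sph lam g ∂(nu haarCircle))) ^ 2) - 1|
      ≤ (12 + 10 * c + 2 * c ^ 2) / k := by
    refine hC.trans (le_of_eq ?_)
    congr 1
    ring
  -- the three rescaled quantities
  set Cov : ℝ := (∫ g, Real.log ‖mat g 0 0‖ * ‖orbit g‖ ^ 2 * ((1 - ‖orbit g‖ ^ 2) ^ (k / 2) * sph lam g)
            ∂(nu haarCircle))
          / (∫ g, (1 - ‖orbit g‖ ^ 2) ^ (k / 2) * sph lam g ∂(nu haarCircle))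
        - ((∫ g, Real.log ‖mat g 0 0‖ * ((1 - ‖orbit g‖ ^ 2) ^ (k / 2) * sph lam g) ∂(nu haarCircle))
            / (∫ g, (1 - ‖orbit g‖ ^ 2) ^ (k / 2) * sph lam g ∂(nu haarCircle)))
          * ((∫ g, ‖orbit g‖ ^ 2 * ((1 - ‖orbit g‖ ^ 2) ^ (k / 2) * sph lam g) ∂(nu haarCircle))
            / (∫ g, (1 - ‖orbit g‖ ^ 2) ^ (k / 2) * sph lam g ∂(nu haarCircle))) with hCov
  set V₁ : ℝ := (∫ g, Real.log ‖mat g 0 0‖ ^ 2 * ((1 - ‖orbit g‖ ^ 2) ^ (k / 2) * sph lam g) ∂(nu haarCircle))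
            / (∫ g, (1 - ‖orbit g‖ ^ 2) ^ (k / 2) * sph lam g ∂(nu haarCircle))
          - ((∫ g, Real.log ‖mat g 0 0‖ * ((1 - ‖orbit g‖ ^ 2) ^ (k / 2) * sph lam g) ∂(nu haarCircle))
            / (∫ g, (1 - ‖orbit g‖ ^ 2) ^ (k / 2) * sph lam g ∂(nu haarCircle))) ^ 2 with hV₁
  set V₂ : ℝ := (∫ g, (‖orbit g‖ ^ 2) ^ 2 * ((1 - ‖orbit g‖ ^ 2) ^ (k / 2) * sph lam g) ∂(nu haarCircle))
            / (∫ g, (1 - ‖orbit g‖ ^ 2) ^ (k / 2) * sph lam g ∂(nu haarCircle))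
          - ((∫ g, ‖orbit g‖ ^ 2 * ((1 - ‖orbit g‖ ^ 2) ^ (k / 2) * sph lam g) ∂(nu haarCircle))
            / (∫ g, (1 - ‖orbit g‖ ^ 2) ^ (k / 2) * sph lam g ∂(nu haarCircle))) ^ 2 with hV₂
  have hk2 : 0 < k ^ 2 / 2 := by positivity
  have e : Cov / Real.sqrt (V₁ * V₂) = (k ^ 2 / 2 * Cov) / Real.sqrt ((k ^ 2 * V₁) * (k ^ 2 / 4 * V₂)) := by
    rw [show (k ^ 2 * V₁) * (k ^ 2 / 4 * V₂) = (k ^ 2 / 2) ^ 2 * (V₁ * V₂) by ring,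
      Real.sqrt_mul (sq_nonneg _), Real.sqrt_sq hk2.le, mul_div_mul_left _ _ hk2.ne']
  rw [e]
  -- the margins: `CB/k ≤ 1/2` and `(12 + 10c + 2c²)/k ≤ 1/2`
  have hm1 : CB / k ≤ 1 / 2 := by
    rw [div_le_div_iff₀ hk0 (by norm_num)]
    linarith
  have hm2 : (12 + 10 * c + 2 * c ^ 2) / k ≤ 1 / 2 := by
    rw [div_le_div_iff₀ hk0 (by norm_num)]
    nlinarith [pow_nonneg hc0 2, pow_nonneg hc0 3, pow_nonneg hc0 4]
  have hB' : 1 / 2 ≤ k ^ 2 * V₁ := by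
    have := (abs_le.mp hB).1
    linarith
  have hC1 : 1 / 2 ≤ k ^ 2 / 4 * V₂ := by
    have := (abs_le.mp hC').1
    linarith
  have hC2 : k ^ 2 / 4 * V₂ ≤ 2 := by
    have := (abs_le.mp hC').2
    linarith
  refine (abs_div_sqrt_mul_sub_one_le hA hB hC' hB' hC1 hC2).trans (le_of_eq ?_)
  rw [hCB]
  ring

end measure

end Summit.Ventures.HodgeRepro2.T5SU11JacobiCovarianceRateOutside
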